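/-
Copyright (c) 2026 the pub-hodgecm-mathlib formalisation cell (harness21).  Prover seat hodgecm-mathlib-K2E3-p12 (g6): Track B «K2-LIT», ENGINE E1 (on loan
per chair word «β → E1»), h413 = stmt-HodgeConjecture-24833; campaign «EIS-WHITTAKER-2» of the dealer K2E1-plan (g4), rung W3 (deal 2026-09-04T07:19:01Z), FILE 1 of 2:
the generic adelic engine.  FILE 2 `K2E1WhittakerCoefficientEulerProductU2` reads it on the big-cell line of `U(1,1)_{L∕L⁺}`.
-/
import Summits.HodgeConjecture.HodgeConjecture.Theorems.AdelicProductIntegralOne                -- ★ (K2E2-p12 g4): Tate 3.3.1 on `𝔸_{K,f}`, `hasProd_localIntegral_of_integrable_one`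
import Summits.HodgeConjecture.HodgeConjecture.Theorems.F0P2wPartialDedekindZetaPole             -- ★ `hasProd_partialDedekindZeta` (`ζ_K^S`, ★ `partialStandardL` currency)
import Literature.NumberTheory.Automorphic.AdeleAddCharProductFormula                            -- ★ Tate 3.2.1 `map_zero_prod_eq_finprod_adicComponent` (`ψ(0,b) = ∏ᶠ_v ψ_v(b_v)`)
import Literature.NumberTheory.Automorphic.GlobalAdditiveCharacter                               -- ★ `adeleAddCharAt_eq_adicComponent` (rfl)
import Literature.NumberTheory.Automorphic.FiniteAdeleSchwartzBruhatFourier                      -- ★ `finiteAdeleAddChar`, `adeleAddChar_eq_mul` (`ψ = ψ_∞ ⊗ ψ_f`)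
import Literature.NumberTheory.Automorphic.AdelicPiSchwartzBruhatFourier                         -- ★ `adeleAddChar_infiniteAdeleInl` (`ψ(y,0) = 𝐞(−Tr y)`)
import Literature.NumberTheory.Automorphic.AdelicAdditiveCharacterDuality                        -- ★ `mixedTrace`, `mixedTrace_ringEquiv_mixedSpace`
import Literature.NumberTheory.Automorphic.AdelicPoissonSummation                                -- ★ `adeleFourierCoeff μ Φ ξ = ∫ Φ(x)·ψ(ξx) dμ` (W1's currency)
import Literature.NumberTheory.Automorphic.AdelicFundamentalDomain                               -- ★ `adeleFundamentalDomain = D_∞ × 𝒪̂`, `measurableSet_adeleFundamentalDomain`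
import Literature.NumberTheory.Automorphic.AdeleRingTopology                                     -- ★ `infiniteAdeleRingHomeomorph : K_∞ ≃ₜ mixedSpace K` (= `ringEquiv_mixedSpace`)
import Mathlib.NumberTheory.NumberField.InfinitePlace.TotallyRealComplex
import Mathlib.NumberTheory.NumberField.Discriminant.Basic
import Mathlib.MeasureTheory.Integral.Pi
import HarnessLib

/-!
# K2·E1 — `K2E1AdelicFourierCoeffEulerProduct` («EIS-WHITTAKER-2», rung W3, FILE 1 of 2): THE ADELIC FOURIER COEFFICIENT OF A PURE TENSOR IS AN EULER PRODUCT —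
# `Φ̂(ξ) = (∫_{K⊗ℝ} Φ_∞·𝐞(−Tr ξs) ds)·(∫_{𝔸_{K,f}} Φ_f·ψ_f(ξ·))`, `μ_f(𝒪̂)⁻¹∫ (∏ᶠ_v g_v)·ψ_f(ξ·) = ∏'_v ν_v(𝒪_v)⁻¹∫ g_v·ψ_v(ξ·)`, `μ(D) = √|d_K|·μ_f(𝒪̂)`, and `∏'_v W_v = (∏_{v∈S}W_v)·ζ_K^S(2z)⁻¹`

Track B ∕ K2-LIT, crux h413 = `stmt-HodgeConjecture-24833`, route of record `HCCMUnconditional`; cell `hodgecm-mathlib`, squad K2, ENGINE E1, campaign «EIS-WHITTAKER-2» (crossing the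
Godement line at `N = 2` for the spherical vector by the Fourier expansion along `N(L⁺)∖N(𝔸) ≅ L⁺∖𝔸_{L⁺}`).  DEAL W3 of K2E1-plan (g4) 07:19:01Z; typed AGAINST the conventions memo of
record `K2/K2E1b-plan/g5/CONVENTIONS-W3W4-EisWhittaker2.K2E1b-plan-g5.md` §0 (R): ONE character (Tate's ★ `adeleAddChar`), the split measure `σ_*(μ_E ⊗ μ_f)`, local means divided by
`ν_v(𝒪_v)` (no self-dual normalisation), the only global constant `|d_K|^{−1∕2}`.  THEOREMS ONLY (no `def`, no instance, no notation, no named-fact hypothesis, no `sorry`; default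
heartbeats); lane `--supports stmt-HodgeConjecture-24833 --as helper` (count-neutral, closes no socket).  GENERIC number field `K` (the campaign's `K = L⁺`); §3 for `K` totally real.

THE MATHEMATICS [TateThesis1967 §3.3, §4.1–4.2; Garrett2018 §1.9–§1.10; Bump1997 §3.7].  W1 ★ `eisensteinSeriesU_sub_borelConstantTerm_eq_two` reads `E − E_B = μ(D)⁻¹·Σ_{ξ≠0} Φ̂_g(ξ)` with
`Φ̂ = adeleFourierCoeff μ Φ`, `Φ̂(ξ) = ∫_{𝔸_K} Φ(x)·ψ(ξx) dμ(x)`, for ANY additive Haar `μ` of `𝔸_K`.  Take `μ := σ_*(μ_E ⊗ μ_f)` along the splitting `σ(s, b) = (ι⁻¹ s, b)` (`ι = ringEquiv_mixedSpace`;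
in the statements `σ` is ANY map with these two components, so consumers instantiate it with their own homeomorphism by `rfl`).
* §1 **`adeleAddChar_mul_eq_fourierChar_mul`**: `ψ(ξx) = 𝐞(−Tr(ξ·ι x_∞))·ψ_f(ξ x_f)` (★ `adeleAddChar_eq_mul`, ★ `adeleAddChar_infiniteAdeleInl`, ★ `mixedTrace_ringEquiv_mixedSpace`);
  **`adeleFourierCoeff_map_split_eq_mul`**: for `Φ(x) = Φ_∞(ι x_∞)·Φ_f(x_f)`, `Φ̂(ξ) = (∫ Φ_∞(s)·𝐞(−Tr(ξs)) dμ_E)·(∫ Φ_f(b)·ψ_f(ξb) dμ_f)` (Mathlib `integral_prod_mul`: no integrability needed,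
  both sides carry the same Bochner junk); **`measure_map_split_adeleFundamentalDomain`**: `μ(D) = μ_E(D_∞)·μ_f(𝒪̂)` (★ `adeleFundamentalDomain = D_∞ × 𝒪̂`).
* §2 **`coe_finiteAdeleAddChar_mul_eq_finprod`**: `ψ_f(ξb) = ∏ᶠ_v ψ_v(ξ·b_v)` (★ Tate 3.2.1; `ψ_v = 1` on `𝒪_v` at EVERY `v`, ★ `adeleAddCharAt_eq_one_of_mem` — no conductor letter enters this file);
  **`hasProd_localCoeff_of_integrable`**: for continuous local factors `g_v`, `= 1` on `𝒪_v` off a finset, with `∏ᶠ_v g_v(b_v) ∈ L¹(μ_f)`: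
  `HasProd (v ↦ ν_v(𝒪_v)⁻¹·∫ g_v(t)·ψ_v(ξt) dν_v) (μ_f(𝒪̂)⁻¹·∫ (∏ᶠ_v g_v(b_v))·ψ_f(ξb) dμ_f)` (★ `AdelicProductIntegralOne` at `f_v = g_v·ψ_v(ξ·)`, exceptional finset `S_g ∪ {v : ξ ∉ 𝒪_v}`).
* §3 (`K` totally real, `μ_E = volume`) **`integral_prod_mul_fourierChar_eq_prod[_of_equiv]`**: `∫ (∏_i φ_i(s_{e i}))·𝐞(−Tr(ξs)) ds = ∏_i ∫_ℝ φ_i(x)·e^{−2πi·ξ_{e i}·x} dx` for any bijection `e : ι ≃ {w ∣ ∞}`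
  (Mathlib `integral_fun_fst`, `integral_fintype_prod_volume_eq_prod`; the one-variable kernel is ★ W2-arch `integral_onePlusSqPow_mul_phase_eq` :144 VERBATIM);
  **`volume_fundamentalDomain_latticeBasis_of_isTotallyReal`**: `volume(D_∞) = √|d_K|` (Mathlib, `r₂ = 0`) — the memo's constant (the symbol algebra `(∏ aᵢ)^w = ∏ aᵢ^w` is ★ `ofReal_prod_cpow`).
* §4 **`hasProd_one_sub_residueCard_cpow`**: `∏_{v∉S}(1 − q_v^{−2z}) = ζ_K^S(2z)⁻¹ ≠ 0⁻¹` on `Re z > ½` (★ `hasProd_partialDedekindZeta` inverted as in ★ p857988 §1);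
  **`hasProd_mul_inv_partialZeta_of_eq_off`**: `W_v = 1 − q_v^{−2z}` off a finset `S` (W2-fin (d), NAMED input) ⟹ `HasProd W ((∏_{v∈S} W_v)·ζ_K^S(2z)⁻¹)` (Mathlib `HasProd.mul_compl`) —
  so W4∕W5 read every Whittaker coefficient as entire archimedean factors × a finite product of polynomials in `q_v^{−z}` × `1∕ζ_K^S(2z)` (holomorphic on `Re z > ½`, ★ p857988 §2).
HONEST LABEL: HC_CM is proved only modulo the 7 printed citations (2 remaining named inputs: hLiu418 = `stmt-HodgeConjecture-24832`, h413 = `stmt-HodgeConjecture-24833`) until rung 0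
closes; this file asserts no named fact and closes no socket; count-neutral.

## References
* [TateThesis1967] J. Tate, *Fourier analysis in number fields and Hecke's zeta-functions*, in Cassels–Fröhlich (1967), Ch. XV: Lemma 3.2.1, Thm 3.3.1, §4.1 Def. 4.1.2–Lemma 4.1.4, Lemma 4.2.4.
* [Garrett2018] P. Garrett, *Modern Analysis of Automorphic Forms by Example* 1 (2018), §1.9–§1.10 (Fourier–Whittaker expansion of Eisenstein series as Euler products).
* [Bump1997] D. Bump, *Automorphic Forms and Representations* (1997), §1.6 (1.26)–(1.27), §3.7.
-/

set_option autoImplicit false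
set_option linter.dupNamespace false -- the mandated namespace repeats `HodgeConjecture.HodgeConjecture`

noncomputable section

open MeasureTheory Measure NumberField NumberField.InfinitePlace NumberField.mixedEmbedding IsDedekindDomain Set Filter Topology
open scoped ENNReal NNReal Real FourierTransform Classical
open Literature.NumberTheory.Automorphic
open Summit.HodgeConjecture.HodgeConjecture.Cruxes.H413

namespace Summit.HodgeConjecture.HodgeConjecture.Cruxes.H413.K2E1AdelicFourierCoeffEulerProduct

/-! ## §1 Splitting the adelic Fourier coefficient of a pure tensor along `(s, b) ↦ (ι⁻¹ s, b)` -/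

section Split

variable (K : Type) [Field K] [NumberField K]

/-- **Tate's character splits**: `ψ(ξ·x) = 𝐞(−Tr(ξ·ι(x_∞)))·ψ_f(ξ·x_f)` for `ξ ∈ K`, `x ∈ 𝔸_K` (`Tr = mixedTrace`, `ι = ringEquiv_mixedSpace`, `ξ·ι(x_∞) = mixedEmbedding K ξ * ι(x_∞)`;
★ `adeleAddChar_eq_mul`, ★ `adeleAddChar_infiniteAdeleInl`, ★ `mixedTrace_ringEquiv_mixedSpace`, Mathlib `mixedEmbedding_eq_algebraMap_comp`). [cite: TateThesis1967, §4.1] -/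
theorem adeleAddChar_mul_eq_fourierChar_mul (ξ : K) (x : AdeleRing (𝓞 K) K) :
    (adeleAddChar K (algebraMap K (AdeleRing (𝓞 K) K) ξ * x) : ℂ) =
      (𝐞 (-(mixedTrace K (mixedEmbedding K ξ * InfiniteAdeleRing.ringEquiv_mixedSpace K x.1))) : ℂ) *
        (finiteAdeleAddChar K (algebraMap K (FiniteAdeleRing (𝓞 K) K) ξ * x.2) : ℂ) := by
  have h1 : (algebraMap K (AdeleRing (𝓞 K) K) ξ * x).1 = algebraMap K (InfiniteAdeleRing K) ξ * x.1 := rfl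
  have h2 : (algebraMap K (AdeleRing (𝓞 K) K) ξ * x).2 = algebraMap K (FiniteAdeleRing (𝓞 K) K) ξ * x.2 := rfl
  rw [adeleAddChar_eq_mul, Circle.coe_mul, adeleAddChar_infiniteAdeleInl, ← mixedTrace_ringEquiv_mixedSpace, h1, h2, map_mul,
    ← InfiniteAdeleRing.mixedEmbedding_eq_algebraMap_comp]

/-- **Tate's domain pulls back to a box**: `σ⁻¹(D) = D_∞ × 𝒪̂` (★ `adeleFundamentalDomain`; `D_∞ = ZSpan.fundamentalDomain (latticeBasis K)`, `𝒪̂ = {b | b_v ∈ 𝒪_v ∀v}`).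
[cite: TateThesis1967, §4.1 Def. 4.1.2] -/
theorem preimage_split_adeleFundamentalDomain {σ : mixedSpace K × FiniteAdeleRing (𝓞 K) K → AdeleRing (𝓞 K) K}
    (hσ : ∀ p, (σ p).1 = (InfiniteAdeleRing.ringEquiv_mixedSpace K).symm p.1 ∧ (σ p).2 = p.2) :
    σ ⁻¹' adeleFundamentalDomain K = (ZSpan.fundamentalDomain (latticeBasis K)) ×ˢ {b : FiniteAdeleRing (𝓞 K) K | ∀ v, b v ∈ v.adicCompletionIntegers K} := by
  ext p
  rw [mem_preimage, mem_adeleFundamentalDomain, (hσ p).1, RingEquiv.apply_symm_apply, and_comm, mem_prod]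
  refine and_congr Iff.rfl (forall_congr' fun v => ?_)
  rw [(hσ p).2]

/-- The splitting `σ` is a measurable embedding (it is a homeomorphism). [folklore] -/
theorem measurableEmbedding_split [MeasurableSpace (AdeleRing (𝓞 K) K)] [BorelSpace (AdeleRing (𝓞 K) K)] [MeasurableSpace (FiniteAdeleRing (𝓞 K) K)] [BorelSpace (FiniteAdeleRing (𝓞 K) K)]
    {σ : mixedSpace K × FiniteAdeleRing (𝓞 K) K → AdeleRing (𝓞 K) K}
    (hσ : ∀ p, (σ p).1 = (InfiniteAdeleRing.ringEquiv_mixedSpace K).symm p.1 ∧ (σ p).2 = p.2) : MeasurableEmbedding σ := by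
  haveI : BorelSpace (mixedSpace K × FiniteAdeleRing (𝓞 K) K) := Prod.borelSpace
  let σh : mixedSpace K × FiniteAdeleRing (𝓞 K) K ≃ₜ AdeleRing (𝓞 K) K := (infiniteAdeleRingHomeomorph K).symm.prodCongr (Homeomorph.refl _)
  have h : σ = ⇑σh := funext fun p => Prod.ext (hσ p).1 (hσ p).2
  rw [h]
  exact σh.measurableEmbedding

/-- **THE ADELIC FOURIER COEFFICIENT OF A PURE TENSOR SPLITS.**  For measures `μ_E` on `mixedSpace K` and `μ_f` on `𝔸_{K,f}` (`SFinite`), the splitting `σ(s, b) = (ι⁻¹ s, b)`, `μ := σ_*(μ_E ⊗ μ_f)`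
on `𝔸_K`, and ANY `Φ_∞ : mixedSpace K → ℂ`, `Φ_f : 𝔸_{K,f} → ℂ`:
`adeleFourierCoeff μ (x ↦ Φ_∞(ι x_∞)·Φ_f(x_f)) ξ = (∫ Φ_∞(s)·𝐞(−Tr(ξs)) dμ_E(s)) · (∫ Φ_f(b)·ψ_f(ξb) dμ_f(b))` (change of variables along the homeomorphism `σ`, the character splits, Mathlib
`integral_prod_mul` — no integrability hypothesis: both sides carry the same Bochner junk). [cite: TateThesis1967, §4.2] [cite: Garrett2018, §1.9] -/
theorem adeleFourierCoeff_map_split_eq_mul [MeasurableSpace (AdeleRing (𝓞 K) K)] [BorelSpace (AdeleRing (𝓞 K) K)] [MeasurableSpace (FiniteAdeleRing (𝓞 K) K)]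
    [BorelSpace (FiniteAdeleRing (𝓞 K) K)] (μE : Measure (mixedSpace K)) [SFinite μE] (μf : Measure (FiniteAdeleRing (𝓞 K) K)) [SFinite μf]
    {σ : mixedSpace K × FiniteAdeleRing (𝓞 K) K → AdeleRing (𝓞 K) K} (hσ : ∀ p, (σ p).1 = (InfiniteAdeleRing.ringEquiv_mixedSpace K).symm p.1 ∧ (σ p).2 = p.2)
    (Φinf : mixedSpace K → ℂ) (Φfin : FiniteAdeleRing (𝓞 K) K → ℂ) (ξ : K) :
    adeleFourierCoeff ((μE.prod μf).map σ) (fun x => Φinf (InfiniteAdeleRing.ringEquiv_mixedSpace K x.1) * Φfin x.2) ξ =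
      (∫ s, Φinf s * (𝐞 (-(mixedTrace K (mixedEmbedding K ξ * s))) : ℂ) ∂μE) *
        ∫ b, Φfin b * (finiteAdeleAddChar K (algebraMap K (FiniteAdeleRing (𝓞 K) K) ξ * b) : ℂ) ∂μf := by
  rw [adeleFourierCoeff_apply, (measurableEmbedding_split K hσ).integral_map, ← integral_prod_mul]
  refine integral_congr_ae (Eventually.of_forall fun p => ?_)
  dsimp only
  rw [adeleAddChar_mul_eq_fourierChar_mul, (hσ p).1, (hσ p).2, RingEquiv.apply_symm_apply]
  ring

/-- **`μ(D) = μ_E(D_∞)·μ_f(𝒪̂)`** for `μ = σ_*(μ_E ⊗ μ_f)` (★ `measurableSet_adeleFundamentalDomain`, Mathlib `Measure.prod_prod`). [cite: TateThesis1967, §4.1 Thm 4.1.3] -/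
theorem measure_map_split_adeleFundamentalDomain [MeasurableSpace (AdeleRing (𝓞 K) K)] [BorelSpace (AdeleRing (𝓞 K) K)] [MeasurableSpace (FiniteAdeleRing (𝓞 K) K)]
    [BorelSpace (FiniteAdeleRing (𝓞 K) K)] (μE : Measure (mixedSpace K)) [SFinite μE] (μf : Measure (FiniteAdeleRing (𝓞 K) K)) [SFinite μf]
    {σ : mixedSpace K × FiniteAdeleRing (𝓞 K) K → AdeleRing (𝓞 K) K} (hσ : ∀ p, (σ p).1 = (InfiniteAdeleRing.ringEquiv_mixedSpace K).symm p.1 ∧ (σ p).2 = p.2) :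
    ((μE.prod μf).map σ) (adeleFundamentalDomain K) = μE (ZSpan.fundamentalDomain (latticeBasis K)) * μf {b : FiniteAdeleRing (𝓞 K) K | ∀ v, b v ∈ v.adicCompletionIntegers K} := by
  rw [Measure.map_apply (measurableEmbedding_split K hσ).measurable (measurableSet_adeleFundamentalDomain _), preimage_split_adeleFundamentalDomain K hσ, Measure.prod_prod]

end Split

/-! ## §2 The finite part is an Euler product (Tate's Theorem 3.3.1 with the character inserted) -/

section Finite

variable (K : Type) [Field K] [NumberField K]

/-- **`ψ_f(b) = ∏_v ψ_v(b_v)`**, almost all factors `1` (★ `map_zero_prod_eq_finprod_adicComponent`, ★ `adeleAddCharAt_eq_adicComponent`). [cite: TateThesis1967, §4.1] -/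
theorem finiteAdeleAddChar_eq_finprod (b : FiniteAdeleRing (𝓞 K) K) :
    finiteAdeleAddChar K b = ∏ᶠ v : HeightOneSpectrum (𝓞 K), adeleAddCharAt K v (b v) := by
  rw [finiteAdeleAddChar_apply, map_zero_prod_eq_finprod_adicComponent (continuous_adeleAddChar K)]
  rfl

/-- The components of `ξ·b` for `ξ ∈ K`: `(ξ b)_v = ξ·b_v` (definitional). [folklore] -/
theorem algebraMap_mul_apply (ξ : K) (b : FiniteAdeleRing (𝓞 K) K) (v : HeightOneSpectrum (𝓞 K)) :
    (algebraMap K (FiniteAdeleRing (𝓞 K) K) ξ * b) v = (ξ : v.adicCompletion K) * b v := rfl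

/-- A family of local factors `g_v(b_v)` with `g_v = 1` on `𝒪_v` off a finset `S` has finite multiplicative support at every finite adele `b` (which is integral off a finite set).
[cite: TateThesis1967, §3.3] -/
theorem finite_mulSupport_localFactor {M : Type*} [One M] {g : ∀ v : HeightOneSpectrum (𝓞 K), v.adicCompletion K → M} {S : Finset (HeightOneSpectrum (𝓞 K))}
    (hg1 : ∀ v ∉ S, ∀ t ∈ v.adicCompletionIntegers K, g v t = 1) (b : FiniteAdeleRing (𝓞 K) K) :
    (Function.mulSupport fun v => g v (b v)).Finite := by
  refine ((S : Set (HeightOneSpectrum (𝓞 K))).toFinite.union (Filter.eventually_cofinite.1 b.2)).subset fun v hv => ?_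
  rw [Function.mem_mulSupport] at hv
  by_contra h
  rw [mem_union, not_or, Finset.mem_coe] at h
  exact hv (hg1 v h.1 _ (not_not.1 h.2))

/-- **`ψ_f(ξb) = ∏_v ψ_v(ξ·b_v)` in `ℂ`** (finitely many factors `≠ 1`: `ψ_v = 1` on `𝒪_v` at EVERY `v`, ★ `adeleAddCharAt_eq_one_of_mem`). [cite: TateThesis1967, §4.1] -/
theorem coe_finiteAdeleAddChar_mul_eq_finprod (ξ : K) (b : FiniteAdeleRing (𝓞 K) K) :
    (finiteAdeleAddChar K (algebraMap K (FiniteAdeleRing (𝓞 K) K) ξ * b) : ℂ) = ∏ᶠ v : HeightOneSpectrum (𝓞 K), (adeleAddCharAt K v ((ξ : v.adicCompletion K) * b v) : ℂ) := by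
  have hfin := finite_mulSupport_localFactor K (S := ∅) (g := fun v t => adeleAddCharAt K v t) (fun v _ t ht => adeleAddCharAt_eq_one_of_mem K v ht)
    (algebraMap K (FiniteAdeleRing (𝓞 K) K) ξ * b)
  have h := map_finprod Circle.coeHom hfin
  simp only [Circle.coeHom_apply] at h
  rw [finiteAdeleAddChar_eq_finprod, h]
  exact finprod_congr fun v => rfl

variable [MeasurableSpace (FiniteAdeleRing (𝓞 K) K)] [BorelSpace (FiniteAdeleRing (𝓞 K) K)]
  [∀ v : HeightOneSpectrum (𝓞 K), MeasurableSpace (v.adicCompletion K)] [∀ v : HeightOneSpectrum (𝓞 K), BorelSpace (v.adicCompletion K)]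

/-- **THE FINITE PART OF A WHITTAKER COEFFICIENT IS AN EULER PRODUCT.**  Let `g_v : K_v → ℂ` be continuous with `g_v = 1` on `𝒪_v` for `v` off a finset `S`, `μ` and `ν_v` additive Haar measures on
`𝔸_{K,f}` and the `K_v`, `ξ ∈ K`, and suppose `G(b) = ∏ᶠ_v g_v(b_v)` is `μ`-integrable.  Then, with `W_v := ν_v(𝒪_v)⁻¹·∫ g_v(t)·ψ_v(ξt) dν_v(t)`,
**`HasProd W (μ(𝒪̂)⁻¹ · ∫ G(b)·ψ_f(ξb) dμ(b))`** — ★ `AdelicProductIntegralOne.hasProd_localIntegral_of_integrable_one` at the local factors `g_v·ψ_v(ξ·)`, which are continuous, `= 1` on `𝒪_v` off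
`S ∪ {v : ξ ∉ 𝒪_v}` (★ `adeleAddCharAt_eq_one_of_mem`: no conductor condition), with `∏ᶠ_v g_v(b_v)ψ_v(ξb_v) = G(b)·ψ_f(ξb)` integrable as `|ψ_f| = 1`. [cite: TateThesis1967, Thm 3.3.1] [cite: Bump1997, §3.7] -/
theorem hasProd_localCoeff_of_integrable (μ : Measure (FiniteAdeleRing (𝓞 K) K)) [μ.IsAddHaarMeasure]
    (ν : ∀ v : HeightOneSpectrum (𝓞 K), Measure (v.adicCompletion K)) [∀ v, (ν v).IsAddHaarMeasure]
    (g : ∀ v : HeightOneSpectrum (𝓞 K), v.adicCompletion K → ℂ) (S : Finset (HeightOneSpectrum (𝓞 K))) (hcont : ∀ v, Continuous (g v))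
    (hg1 : ∀ v ∉ S, ∀ t ∈ v.adicCompletionIntegers K, g v t = 1) (ξ : K) (hint : Integrable (fun b : FiniteAdeleRing (𝓞 K) K => ∏ᶠ v, g v (b v)) μ) :
    HasProd (fun v : HeightOneSpectrum (𝓞 K) => (ν v (v.adicCompletionIntegers K)).toReal⁻¹ • ∫ t, g v t * (adeleAddCharAt K v ((ξ : v.adicCompletion K) * t) : ℂ) ∂ν v)
      ((μ {b | ∀ v, b v ∈ v.adicCompletionIntegers K}).toReal⁻¹ •
        ∫ b, (∏ᶠ v, g v (b v)) * (finiteAdeleAddChar K (algebraMap K (FiniteAdeleRing (𝓞 K) K) ξ * b) : ℂ) ∂μ) := by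
  classical
  -- the finset of places where `ξ` is not integral
  set Sξ : Finset (HeightOneSpectrum (𝓞 K)) := (Filter.eventually_cofinite.1 (algebraMap K (FiniteAdeleRing (𝓞 K) K) ξ).2).toFinset with hSξ
  have hξint : ∀ v ∉ Sξ, (ξ : v.adicCompletion K) ∈ v.adicCompletionIntegers K := by
    intro v hv
    by_contra h
    exact hv ((Set.Finite.mem_toFinset _).2 h)
  -- the local factors `f_v = g_v · ψ_v(ξ ·)`
  have hcont' : ∀ v, Continuous fun t : v.adicCompletion K => g v t * (adeleAddCharAt K v ((ξ : v.adicCompletion K) * t) : ℂ) := fun v =>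
    (hcont v).mul (continuous_subtype_val.comp ((continuous_adeleAddCharAt K v).comp (continuous_const.mul continuous_id)))
  have hf1' : ∀ v ∉ S ∪ Sξ, ∀ t ∈ v.adicCompletionIntegers K, g v t * (adeleAddCharAt K v ((ξ : v.adicCompletion K) * t) : ℂ) = 1 := by
    intro v hv t ht
    rw [Finset.mem_union, not_or] at hv
    rw [hg1 v hv.1 t ht, adeleAddCharAt_eq_one_of_mem K v (mul_mem (hξint v hv.2) ht), Circle.coe_one, one_mul]
  -- pointwise: `∏ᶠ_v g_v(b_v)ψ_v(ξ b_v) = G(b)·ψ_f(ξ b)`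
  have hpt : ∀ b : FiniteAdeleRing (𝓞 K) K, (∏ᶠ v, g v (b v) * (adeleAddCharAt K v ((ξ : v.adicCompletion K) * b v) : ℂ)) =
      (∏ᶠ v, g v (b v)) * (finiteAdeleAddChar K (algebraMap K (FiniteAdeleRing (𝓞 K) K) ξ * b) : ℂ) := by
    intro b
    rw [coe_finiteAdeleAddChar_mul_eq_finprod, finprod_mul_distrib]
    · exact finite_mulSupport_localFactor K hg1 b
    · exact finite_mulSupport_localFactor K (S := ∅) (g := fun v t => (adeleAddCharAt K v t : ℂ))
        (fun v _ t ht => by rw [adeleAddCharAt_eq_one_of_mem K v ht, Circle.coe_one]) (algebraMap K (FiniteAdeleRing (𝓞 K) K) ξ * b)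
  -- integrability of the product function: `|ψ_f| = 1`
  have hint' : Integrable (fun b : FiniteAdeleRing (𝓞 K) K => ∏ᶠ v, g v (b v) * (adeleAddCharAt K v ((ξ : v.adicCompletion K) * b v) : ℂ)) μ := by
    simp_rw [hpt]
    refine hint.mul_bdd (c := 1) ?_ (Eventually.of_forall fun b => ?_)
    · exact (continuous_subtype_val.comp ((continuous_finiteAdeleAddChar K).comp (continuous_const.mul continuous_id))).aestronglyMeasurable
    · rw [Circle.norm_coe]
  have h := AdelicProductIntegralOne.hasProd_localIntegral_of_integrable_one K μ ν
    (fun v t => g v t * (adeleAddCharAt K v ((ξ : v.adicCompletion K) * t) : ℂ)) (S ∪ Sξ) hcont' hf1' hint'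
  simp_rw [hpt] at h
  exact h

end Finite

/-! ## §3 The archimedean part over a totally real field is the product of the one-variable transforms -/

section Arch

variable (K : Type) [Field K] [NumberField K]

/-- `𝐞(−Σ_w a_w s_w) = ∏_w e^{−2πi·a_w·s_w}` in `ℂ` (Mathlib `Real.fourierChar_apply`, `Complex.exp_sum`) — the link between Tate's kernel and the one-variable kernel of ★ W2-arch
`integral_onePlusSqPow_mul_phase_eq`. [folklore] -/
theorem coe_fourierChar_neg_sum {ι : Type*} [Fintype ι] (a s : ι → ℝ) :
    (𝐞 (-(∑ i, a i * s i)) : ℂ) = ∏ i, Complex.exp (-(2 * π * Complex.I * a i * s i)) := by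
  rw [Real.fourierChar_apply, ← Complex.exp_sum]
  congr 1
  push_cast
  rw [mul_neg, Finset.mul_sum, neg_mul, Finset.sum_mul, ← Finset.sum_neg_distrib]
  exact Finset.sum_congr rfl fun i _ => by ring

/-- Over a TOTALLY REAL `K` the trace form is the plain sum of the real coordinates: `Tr(ξ·s) = Σ_w ξ_w·s_w` (no complex places; `ξ_w = (mixedEmbedding K ξ).1 w`). [folklore] -/
theorem mixedTrace_mixedEmbedding_mul_of_isTotallyReal [IsTotallyReal K] (ξ : K) (s : mixedSpace K) :
    mixedTrace K (mixedEmbedding K ξ * s) = ∑ w : {w : InfinitePlace K // IsReal w}, (mixedEmbedding K ξ).1 w * s.1 w := by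
  haveI : IsEmpty {w : InfinitePlace K // IsComplex w} := ⟨fun w => (not_isReal_iff_isComplex.2 w.2) (IsTotallyReal.isReal w.1)⟩
  simp only [mixedTrace_apply, Finset.univ_eq_empty, Finset.sum_empty, add_zero]
  rfl

/-- **THE ARCHIMEDEAN WHITTAKER FACTOR SPLITS OVER THE REAL PLACES** (`K` totally real, Lebesgue measure on `mixedSpace K = (w → ℝ) × (∅ → ℂ)`): for any `φ_w : ℝ → ℂ`,
`∫ (∏_w φ_w(s_w))·𝐞(−Tr(ξs)) ds = ∏_w ∫_ℝ φ_w(x)·e^{−2πi·ξ_w·x} dx`, `ξ_w = (mixedEmbedding K ξ)_w` — each factor is the kernel of ★ W2-arch :144 (Mathlib `integral_fun_fst` to discard the trivial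
complex factor, `integral_fintype_prod_volume_eq_prod`). [cite: TateThesis1967, §4.1] [cite: Bump1997, §1.6 (1.26)] -/
theorem integral_prod_mul_fourierChar_eq_prod [IsTotallyReal K] (φ : {w : InfinitePlace K // IsReal w} → ℝ → ℂ) (ξ : K) :
    ∫ s : mixedSpace K, (∏ w, φ w (s.1 w)) * (𝐞 (-(mixedTrace K (mixedEmbedding K ξ * s))) : ℂ) =
      ∏ w : {w : InfinitePlace K // IsReal w}, ∫ x : ℝ, φ w x * Complex.exp (-(2 * π * Complex.I * (mixedEmbedding K ξ).1 w * x)) := by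
  haveI : IsEmpty {w : InfinitePlace K // IsComplex w} := ⟨fun w => (not_isReal_iff_isComplex.2 w.2) (IsTotallyReal.isReal w.1)⟩
  -- the integrand is a function of the real coordinates alone, a product over the real places
  have hF : (fun s : mixedSpace K => (∏ w, φ w (s.1 w)) * (𝐞 (-(mixedTrace K (mixedEmbedding K ξ * s))) : ℂ)) =
      fun s => (fun x : {w : InfinitePlace K // IsReal w} → ℝ => ∏ w, φ w (x w) * Complex.exp (-(2 * π * Complex.I * (mixedEmbedding K ξ).1 w * x w))) s.1 := by
    funext s
    dsimp only
    rw [mixedTrace_mixedEmbedding_mul_of_isTotallyReal, coe_fourierChar_neg_sum, Finset.prod_mul_distrib]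
  have h1 : (volume : Measure ({w : InfinitePlace K // IsComplex w} → ℂ)).real univ = 1 := by
    rw [measureReal_def, volume_pi, Measure.pi_univ, Finset.prod_of_isEmpty, ENNReal.toReal_one]
  have key := integral_fun_fst (μ := (volume : Measure ({w : InfinitePlace K // IsReal w} → ℝ))) (ν := (volume : Measure ({w : InfinitePlace K // IsComplex w} → ℂ)))
    (fun x : {w : InfinitePlace K // IsReal w} → ℝ => ∏ w, φ w (x w) * Complex.exp (-(2 * π * Complex.I * (mixedEmbedding K ξ).1 w * x w)))
  have key2 := integral_fintype_prod_volume_eq_prod (𝕜 := ℂ)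
    (fun (w : {w : InfinitePlace K // IsReal w}) (y : ℝ) => φ w y * Complex.exp (-(2 * π * Complex.I * (mixedEmbedding K ξ).1 w * y)))
  rw [h1, one_smul] at key
  rw [hF, volume_eq_prod]
  exact key.trans key2

/-- The same with the real places RE-INDEXED along any bijection `e : ι ≃ {w ∣ ∞ real}` (for the CM pair the natural index is the set of complex places `w` of `L`, `e w = w|_{L⁺}`, Mathlib
`IsCMField.equivInfinitePlace`): `∫ (∏_i φ_i(s_{e i}))·𝐞(−Tr(ξs)) ds = ∏_i ∫_ℝ φ_i(x)·e^{−2πi·ξ_{e i}·x} dx`. [cite: TateThesis1967, §4.1] [cite: Bump1997, §1.6 (1.26)] -/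
theorem integral_prod_mul_fourierChar_eq_prod_of_equiv [IsTotallyReal K] {ι : Type*} [Fintype ι] (e : ι ≃ {w : InfinitePlace K // IsReal w}) (φ : ι → ℝ → ℂ) (ξ : K) :
    ∫ s : mixedSpace K, (∏ i, φ i (s.1 (e i))) * (𝐞 (-(mixedTrace K (mixedEmbedding K ξ * s))) : ℂ) =
      ∏ i, ∫ x : ℝ, φ i x * Complex.exp (-(2 * π * Complex.I * (mixedEmbedding K ξ).1 (e i) * x)) := by
  have h := integral_prod_mul_fourierChar_eq_prod K (fun w => φ (e.symm w)) ξ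
  have hre : ∀ s : mixedSpace K, (∏ w, φ (e.symm w) (s.1 w)) = ∏ i, φ i (s.1 (e i)) := fun s =>
    (Fintype.prod_equiv e _ _ fun i => by rw [Equiv.symm_apply_apply]).symm
  simp_rw [hre] at h
  rw [h]
  exact (Fintype.prod_equiv e _ _ fun i => by rw [Equiv.symm_apply_apply]).symm

/-- `volume(D_∞) = √|d_K|` for a TOTALLY REAL `K` (Mathlib `volume_fundamentalDomain_latticeBasis` with `r₂ = 0`) — so `μ(D) = √|d_K|·μ_f(𝒪̂)` in §1, the memo's constant `|d_{L⁺}|^{−1∕2}`.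
[cite: TateThesis1967, §4.1 Lemma 4.1.4] -/
theorem volume_fundamentalDomain_latticeBasis_of_isTotallyReal [IsTotallyReal K] :
    volume (ZSpan.fundamentalDomain (latticeBasis K)) = ENNReal.ofNNReal (NNReal.sqrt ‖discr K‖₊) := by
  rw [volume_fundamentalDomain_latticeBasis, IsTotallyReal.nrComplexPlaces_eq_zero, pow_zero, one_mul]

end Arch

/-! ## §4 Regrouping the finite Euler product off a finite set `S`: `∏'_v W_v = (∏_{v∈S} W_v)·ζ_K^S(2z)⁻¹` -/

section Regroup

variable {K : Type} [Field K] [NumberField K]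

/-- **THE INVERTED EULER PRODUCT `∏_{v∉S}(1 − q_v^{−2z}) = ζ_K^S(2z)⁻¹` on `Re z > ½`** (★ `hasProd_partialDedekindZeta` at `s = 2z`, inverted through `Tendsto.inv₀` as in ★ p857988 §1;
`ζ_K^S = partialStandardL S (fun _ => {1})`, `≠ 0` there). [cite: TateThesis1967, §4.1] -/
theorem hasProd_one_sub_residueCard_cpow (S : Set (HeightOneSpectrum (𝓞 K))) {z : ℂ} (hz : 1 / 2 < z.re) :
    HasProd (fun v : {v : HeightOneSpectrum (𝓞 K) // v ∉ S} => 1 - (v.1.residueCard : ℂ) ^ (-(2 * z)))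
        (Literature.NumberTheory.Automorphic.partialStandardL S (fun _ => ({1} : Multiset ℂ)) (2 * z))⁻¹ ∧
      Literature.NumberTheory.Automorphic.partialStandardL S (fun _ => ({1} : Multiset ℂ)) (2 * z) ≠ 0 := by
  have h2 : 1 < (2 * z).re := by rw [Complex.mul_re]; norm_num; linarith
  obtain ⟨h, hne⟩ := F0P2wPartialDedekindZetaPole.hasProd_partialDedekindZeta (K := K) (S := S) (s := 2 * z) h2
  refine ⟨?_, hne⟩
  unfold HasProd at h ⊢
  have hi := h.inv₀ hne
  simp only [← Finset.prod_inv_distrib, inv_inv] at hi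
  exact hi

/-- **REGROUPING OFF A FINITE SET.**  If `W_v = 1 − q_v^{−2z}` for every `v ∉ S` (`S` a finset; the unramified values of W2-fin (d), taken as a NAMED input `hW`) and `Re z > ½`, then
**`HasProd W ((∏_{v∈S} W_v) · ζ_K^S(2z)⁻¹)`** — the whole finite Euler product is a FINITE product times `1∕ζ_K^S(2z)` (Mathlib `HasProd.mul_compl`; `ζ_K^S(2z)` is holomorphic and zero-free on
`Re z > ½`, ★ p857988 §2, so W4∕W5 see an entire numerator over `ζ_K^S(2z)`). [cite: Bump1997, §3.7] [cite: Garrett2018, §1.10] -/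
theorem hasProd_mul_inv_partialZeta_of_eq_off {W : HeightOneSpectrum (𝓞 K) → ℂ} (S : Finset (HeightOneSpectrum (𝓞 K))) {z : ℂ} (hz : 1 / 2 < z.re)
    (hW : ∀ v ∉ S, W v = 1 - (v.residueCard : ℂ) ^ (-(2 * z))) :
    HasProd W ((∏ v ∈ S, W v) * (Literature.NumberTheory.Automorphic.partialStandardL (S : Set (HeightOneSpectrum (𝓞 K))) (fun _ => ({1} : Multiset ℂ)) (2 * z))⁻¹) ∧
      Literature.NumberTheory.Automorphic.partialStandardL (S : Set (HeightOneSpectrum (𝓞 K))) (fun _ => ({1} : Multiset ℂ)) (2 * z) ≠ 0 := by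
  obtain ⟨h, hne⟩ := hasProd_one_sub_residueCard_cpow (K := K) (S : Set (HeightOneSpectrum (𝓞 K))) hz
  refine ⟨HasProd.mul_compl (s := (S : Set (HeightOneSpectrum (𝓞 K)))) ?_ ?_, hne⟩
  · have hf := hasProd_fintype (W ∘ (↑) : (↑S : Set (HeightOneSpectrum (𝓞 K))) → ℂ)
    rwa [show (∏ b : (↑S : Set (HeightOneSpectrum (𝓞 K))), (W ∘ (↑)) b) = ∏ v ∈ S, W v from Finset.prod_coe_sort S W] at hf
  · exact h.congr_fun fun v => hW v.1 fun hv => v.2 (Finset.mem_coe.2 hv)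

end Regroup

end Summit.HodgeConjecture.HodgeConjecture.Cruxes.H413.K2E1AdelicFourierCoeffEulerProduct

end
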